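import Literature.IUT.LogThetaLattice.StripFrameOfKits
import Literature.IUT.LogThetaLattice.BiCores

/-!
# `BiCoricData.ofKits`: the log-shell / bi-core data of [IUTchIII] §1 over the frame ASSEMBLED from the [IUTchI] kits

Mochizuki, *Inter-universal Teichmüller Theory III*, kurims manuscript (May 2020), Def 1.1 (iv)–(vi) pp. 27–28,
Prop 1.2 (vi)–(ix) pp. 32–34, Thm 1.5 (iii)–(v) pp. 48–51; *II* (Dec 2020), Cor 4.5 (ii) p. 132, Cor 4.6 (i)(ii)
p. 136, Rmk 4.5.1 (i) p. 133, Cor 4.10 (i)(iv)(v) pp. 158–161. ([IUTchIII] Prop 1.2 (viii) p.33)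
[claim: Mochizuki2012, status: disputed]. MERGE-MAP plan/L6/MERGE-MAP.md §1 row 130 («`BiCoricData` … bridge in merge
phase via `StripFrame`»); plan/L6/SUBDAG-IUTchIII-Prop-12.md row r16a («the `FofD` slot of `BiCoricData` for the real
frame `StripFrame.ofKits` … real inhabitant owed by the `BiCoricData` instantiation over `StripFrame.ofKits`,
L6-t3»). Consumer seat abc-iut-L6-t3 (gen 4). Nothing of the series is asserted; typed ≠ discharged.

`Literature.IUT.LogThetaLattice.BiCoricData S` (`BiCores.lean`, this seat, gen 0/2) is the INTERFACE over a strip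
frame `S` recording the mono-analytic / holomorphic log-shell algorithms [Def 1.1 (iv)–(vi), Prop 1.2 (vi)–(ix);
AbsTopIII Prop 5.8], the bi-coric `F^{⊢×μ}`-prime-strips `F^{⊢×μ}_△(^{n,m}D^⊢_△)` with their Kummer isomorphisms
[Thm 1.5 (iii)(iv); IUTchII Cor 4.6 (i), 4.10 (i)(iv)] and the realified data `D^⊩(−)` with the `ℝ_{>0}`-orbits of
Kummer isomorphisms [Thm 1.5 (v); IUTchII Cor 4.5 (ii), 4.6 (ii), 4.10 (v)]. Every [IUTchIII] Thm 1.5 (iii)–(v)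
discharge in the tree (abc-iut-w4-d006/d009/d014/d005: `BiCoresProofsIII/IVV`, `BiCoresRealifiedRigidity`, …) is a
theorem about an ARBITRARY `B : BiCoricData S`; `LatticeGlue S` (this seat) — the input of the Cor 3.12 crew's
`Summit.ABC.IUTFork.Thm311.LinkData.ofGlue` — has a `BiCoricData S` field.

This file supplies the CONSTRUCTOR over the real frame `StripFrame.ofKits L hbij hsurj hR X` (`StripFrameOfKits`):
* `BiCoricKit X` — the SAME data at the level of the kits: functors on abc-iut-L5-t4's `ℱ`-prime-strips
  `FK.FStrip`, the [IUTchII] Def 4.9 input's `F^{⊢×μ}`-prime-strips `X.Fxm`, the `𝒟^⊢`-prime-strips `M.DMono`, the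
  `𝒟`-prime-strips `K.DStrip`, and this seat's representative-level Hodge-theater groupoids `HTRep FK`, `DHTRep K`;
  every field quotes the `BiCoricData` field it instantiates. Like `TimesMuPassages` (`TimesMuSideOfStrips`) this is
  an INPUT BY NAME: the kits' ambient categories are abstract, and the genuine algorithms ([AbsTopIII] Prop 5.8 /
  Cor 5.10 log-shells, owner abc-iut-L4-t3; [IUTchII] Cor 4.5/4.6 `D ↦ Ψ_cns(D)`, `D^⊢ ↦ D^⊩(D^⊢)`, owner
  abc-iut-L6-t2) are to be plugged into it when their outputs are functors on the kits' categories;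
* `BiCoricData.ofKits : BiCoricKit X → BiCoricData (StripFrame.ofKits L hbij hsurj hR X)` — transport along
  Mathlib's `AsSmall` (the frame's categories are the small models of the kits' categories): functors by `liftF`,
  the printed NATURAL isomorphisms componentwise (`§ 1`), the printed ORBITS of isomorphisms (object-wise
  poly-isomorphisms) by `PolyIso.map AsSmall.up` (`liftPoly`), and the two LAWS of the interface — transport of
  the `Ism`-orbit (resp. `{±1}`-orbit) along isomorphisms of `F^{⊢×μ}`-prime-strips (`monoFxm_map`) and "the `†F`-level
  isomorphisms lie in the orbit constructed from `†F^{⊢×μ}` alone" (`monoFxmOfF_le`) — PROVED from the kit-level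
  laws (`§ 2`). The label `≻` is the frame's one label (`Label := PUnit`, DISCLOSED TRUNCATION (1) of
  `StripFrameOfKits`).
Universe-generic in the kit (`K : PMBaseKit.{u} l`); over `TimesMuSide.ofPassages` (`TimesMuSideOfStrips`) take
`u := max (v+1) w`.
-/

namespace Literature.IUT.LogThetaLattice

open CategoryTheory
open Literature.IUT.HodgeTheaters Literature.IUT.HodgeTheaters.PMBaseKit

universe w v v' u u'

/-! ### 1. More transport along `AsSmall`: identities, triple composites, poly-isomorphisms -/

namespace AsSmallTransport

variable {C : Type u} [Category.{v} C] {D : Type u'} [Category.{v'} D]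

/-- **IUTchIII:Def1.1** (kurims p.23) `liftF Φ` on an isomorphism is `Φ` on the underlying isomorphism, re-wrapped.
([IUTchIII] Def 1.1 p.23) [claim: Mochizuki2012, status: disputed] -/
theorem liftF_mapIso (Φ : C ⥤ D) {X Y : AsSmall.{w} C} (f : X ≅ Y) :
    (liftF Φ).mapIso f = AsSmall.up.mapIso (Φ.mapIso (AsSmall.down.mapIso f)) := Iso.ext rfl

/-- **IUTchIII:Def1.1** (kurims p.23) Re-wrapping an unwrapped isomorphism gives it back.
([IUTchIII] Def 1.1 p.23) [claim: Mochizuki2012, status: disputed] -/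
theorem up_mapIso_down_mapIso {X Y : AsSmall.{w} C} (f : X ≅ Y) :
    AsSmall.up.mapIso (AsSmall.down.mapIso f) = f := Iso.ext rfl

/-- **IUTchI:§0** (kurims p.33) A poly-isomorphism of the ambient category transported to the small models ("induces a
poly-isomorphism"). ([IUTchI] §0 p.33) [claim: Mochizuki2012, status: disputed] -/
abbrev liftPoly {a b : C} (P : PolyIso a b) :
    PolyIso ((AsSmall.up : C ⥤ AsSmall.{w} C).obj a) ((AsSmall.up : C ⥤ AsSmall.{w} C).obj b) :=
  P.map AsSmall.up

/-- **IUTchI:§0** (kurims p.33) Membership in a transported poly-isomorphism: the underlying isomorphism belongs to the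
original. ([IUTchI] §0 p.33) [claim: Mochizuki2012, status: disputed] -/
theorem mem_liftPoly_iff {a b : C} (P : PolyIso a b)
    (e : (AsSmall.up : C ⥤ AsSmall.{w} C).obj a ≅ (AsSmall.up : C ⥤ AsSmall.{w} C).obj b) :
    e ∈ liftPoly P ↔ AsSmall.down.mapIso e ∈ P := by
  constructor
  · rintro ⟨f, hf, rfl⟩
    have h : AsSmall.down.mapIso ((AsSmall.up : C ⥤ AsSmall.{w} C).mapIso f) = f := Iso.ext rfl
    rw [h]
    exact hf
  · intro h
    exact ⟨_, h, up_mapIso_down_mapIso e⟩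

/-- **IUTchI:§0** (kurims p.33) A nonempty poly-isomorphism transports to a nonempty one.
([IUTchI] §0 p.33) [claim: Mochizuki2012, status: disputed] -/
theorem liftPoly_nonempty {a b : C} {P : PolyIso a b} (h : P.Nonempty) : (liftPoly.{w} P).Nonempty :=
  PolyIso.Nonempty.map _ h

/-- **IUTchI:§0** (kurims p.33) Transport of poly-isomorphisms is monotone.
([IUTchI] §0 p.33) [claim: Mochizuki2012, status: disputed] -/
theorem liftPoly_mono {a b : C} {P Q : PolyIso a b} (h : P ⊆ Q) : liftPoly.{w} P ⊆ liftPoly.{w} Q :=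
  Set.image_mono h

variable {E : Type*} [Category E] {E' : Type*} [Category E']

/-- **IUTchIII:Def1.1** (kurims p.23) A natural isomorphism `Φ ⋙ Ψ ≅ 𝟭` transported to the small models.
([IUTchIII] Def 1.1 p.23) [claim: Mochizuki2012, status: disputed] -/
def liftUnit {Φ : C ⥤ D} {Ψ : D ⥤ C} (e : Φ ⋙ Ψ ≅ 𝟭 C) : liftF.{w} Φ ⋙ liftF Ψ ≅ 𝟭 (AsSmall.{w} C) :=
  NatIso.ofComponents (fun X => AsSmall.up.mapIso (e.app (ULift.down X)))
    (fun f => ULift.ext _ _ (e.hom.naturality f.down))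

/-- **IUTchIII:Def1.1** (kurims p.23) A natural isomorphism `Φ ≅ (Ψ ⋙ Θ) ⋙ Ω` transported to the small models.
([IUTchIII] Def 1.1 p.23) [claim: Mochizuki2012, status: disputed] -/
def liftIsoComp₃ {Φ : C ⥤ E'} {Ψ : C ⥤ D} {Θ : D ⥤ E} {Ω : E ⥤ E'} (e : Φ ≅ (Ψ ⋙ Θ) ⋙ Ω) :
    liftF.{w} Φ ≅ (liftF.{w} Ψ ⋙ liftF Θ) ⋙ liftF Ω :=
  NatIso.ofComponents (fun X => AsSmall.up.mapIso (e.app (ULift.down X)))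
    (fun f => ULift.ext _ _ (e.hom.naturality f.down))

end AsSmallTransport

open AsSmallTransport

variable {l : ℕ} {K : PMBaseKit.{u} l} {M : K.MultKit} {FK : K.FKit M} {L : FK.MonoLaws}

/-! ### 2. The kit-level data -/

/-- **IUTchIII:Prop1.2(viii)** (kurims p.33) KIT-LEVEL INPUT for `BiCoricData` over the assembled frame: the data of this seat's
interface `BiCoricData` ([IUTchIII] Def 1.1 (iv)–(vi), Prop 1.2 (vi)–(ix), Thm 1.5 (iii)–(v); [IUTchII] Cor 4.5 (ii), 4.6 (i)(ii),
4.10 (i)(iv)(v), Rmk 4.5.1 (i)) as functors / natural isomorphisms / object-wise poly-isomorphisms on abc-iut-L5-t4's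
kit categories (`FK.FStrip`, `K.DStrip`, `M.DMono`), the [IUTchII] Def 4.9 input's `X.Fxm` and the representative-level
Hodge-theater groupoids `HTRep FK`, `DHTRep K`. Each field quotes the `BiCoricData` field it instantiates (there: the printed
sentence). INPUT BY NAME (owners of the algorithms: abc-iut-L4-t3 [AbsTopIII] Prop 5.8 / Cor 5.10; abc-iut-L6-t2 [IUTchII]
Cor 4.5/4.6/4.10; TODO-merge). ([IUTchIII] Prop 1.2 (viii) p.33) [claim: Mochizuki2012, status: disputed] -/
structure BiCoricKit (X : TimesMuSide FK L) : Type (u + 1) where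
  /-- `BiCoricData.Sh`: collections `{I_v ⊆ log(−)_v}_{v∈𝕍}` [Prop 1.2 (viii); AbsTopIII Prop 5.8] -/
  Sh : Type u
  [catSh : Category.{u} Sh]
  /-- `BiCoricData.holShell`: `†𝔉 ↦ {I_{†𝔉} ⊆ log(†𝔉)}` [Def 1.1 (iii) p.27] on the kit's `ℱ`-prime-strips -/
  holShell : FK.FStrip ⥤ Sh
  /-- `BiCoricData.fxmShell`: `†𝔉^{⊢×μ} ↦ {I_{†𝔉^{⊢×μ}} ⊆ log(†𝔉^{⊢×μ})}` [Def 1.1 (vi) p.28] -/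
  fxmShell : X.Fxm ⥤ Sh
  /-- `BiCoricData.monoShell`: `†𝔇^⊢ ↦ {I_{†𝔇^⊢} ⊆ log(†𝔇^⊢)}` [Prop 1.2 (vi)(vii)(viii)] on the kit's `𝒟^⊢`-prime-strips -/
  monoShell : M.DMono ⥤ Sh
  /-- `BiCoricData.monoFxm`: the `Ism`-orbit (resp. `{±1}`-orbit) `log(†𝔇^⊢) ⥲ log(†𝔉^{⊢×μ})` [Prop 1.2 (vi) p.32 / (vii) p.33] -/
  monoFxm : ∀ A : X.Fxm, PolyIso (monoShell.obj (X.FxmToDv.obj A)) (fxmShell.obj A)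
  /-- it is nonempty -/
  monoFxm_nonempty : ∀ A : X.Fxm, (monoFxm A).Nonempty
  /-- `BiCoricData.monoFxm_map`: transport along isomorphisms of `F^{⊢×μ}`-prime-strips preserves the orbit -/
  monoFxm_map : ∀ {A B : X.Fxm} (f : A ≅ B) (e : monoShell.obj (X.FxmToDv.obj A) ≅ fxmShell.obj A),
    e ∈ monoFxm A → (monoShell.mapIso (X.FxmToDv.mapIso f)).symm ≪≫ e ≪≫ fxmShell.mapIso f ∈ monoFxm B
  /-- `BiCoricData.monoFxmOfF`: the `†𝔉`-level [poly-]isomorphism `log(†𝔇^⊢) ⥲ log(†𝔉^{⊢×μ})` [Prop 1.2 (vi)/(vii), second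
  display], at the `F^{⊢×μ}`-prime-strip of `†𝔉` (`𝔉 ↦ 𝔉^⊢ ↦ 𝔉^{⊢×μ}`: abc-iut-L6-t7's `monoFunctor` then the Def 4.9 input) -/
  monoFxmOfF : ∀ F : FK.FStrip,
    PolyIso (monoShell.obj (X.FxmToDv.obj ((PrimeStripGroupoids.monoFunctor FK ⋙ X.FvToFxm).obj F)))
      (fxmShell.obj ((PrimeStripGroupoids.monoFunctor FK ⋙ X.FvToFxm).obj F))
  /-- it is nonempty -/
  monoFxmOfF_nonempty : ∀ F : FK.FStrip, (monoFxmOfF F).Nonempty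
  /-- `BiCoricData.monoFxmOfF_le`: "the `†F`-level isomorphisms lie in the `Ism`-orbit constructed from `†F^{⊢×μ}` alone" -/
  monoFxmOfF_le : ∀ F : FK.FStrip, monoFxmOfF F ⊆ monoFxm ((PrimeStripGroupoids.monoFunctor FK ⋙ X.FvToFxm).obj F)
  /-- `BiCoricData.fxmHol`: `log(†𝔉^{⊢×μ}) ⥲ log(†𝔉)` [Prop 1.2 (vi)/(vii)] -/
  fxmHol : ∀ F : FK.FStrip,
    PolyIso (fxmShell.obj ((PrimeStripGroupoids.monoFunctor FK ⋙ X.FvToFxm).obj F)) (holShell.obj F)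
  /-- it is nonempty -/
  fxmHol_nonempty : ∀ F : FK.FStrip, (fxmHol F).Nonempty
  /-- `BiCoricData.FofD`: `*𝔇 ↦ F(*𝔇)` "the `F`-prime-strip naturally determined by `Ψ_cns(*D)`" [IUTchII, Rmk 4.5.1 (i)] -/
  FofD : K.DStrip ⥤ FK.FStrip
  /-- `BiCoricData.FofD_D`: the `𝒟`-prime-strip of `F(*𝔇)` is `*𝔇` (abc-iut-L6-t7's `assocDFunctor`) -/
  FofD_D : FofD ⋙ PrimeStripGroupoids.assocDFunctor FK ≅ 𝟭 _
  /-- `BiCoricData.fxmOfDv`: Thm 1.5 (iii) `^{n,m}𝔇^⊢_△ ↦ F^{⊢×μ}_△(^{n,m}𝔇^⊢_△)` -/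
  fxmOfDv : M.DMono ⥤ X.Fxm
  /-- `BiCoricData.fxmOfDv_dv`: the `𝒟^⊢`-prime-strip of `F^{⊢×μ}_△(𝔇^⊢)` is `𝔇^⊢` -/
  fxmOfDv_dv : fxmOfDv ⋙ X.FxmToDv ≅ 𝟭 _
  /-- `BiCoricData.dvDelta`: `†ℋ𝒯^𝒟 ↦ †𝔇^⊢_△` [IUTchII, Cor 4.10 (i)] on representatives of `𝒟-Θ^{±ell}`-Hodge theaters -/
  dvDelta : DHTRep K ⥤ M.DMono
  /-- `BiCoricData.fxOfDsucc`: Thm 1.5 (iii) p.49 `†𝔇_≻ ↦ F^{⊢×μ}_△(†𝔇_≻)` -/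
  fxOfDsucc : K.DStrip ⥤ X.Fxm
  /-- `BiCoricData.fxOfDsucc_delta`: the "natural isomorphism `F^{⊢×}_△(^{n,m}𝔇_≻) ⥲ F^{⊢×}_△(^{n,m}𝔇^⊢_△)`", functorial in the
  `𝒟`-Hodge theater (`†ℋ𝒯^𝒟 ↦ †𝔇_≻` = this seat's `DHTRep.codFunctor`) -/
  fxOfDsucc_delta : DHTRep.codFunctor ⋙ fxOfDsucc ≅ dvDelta ⋙ fxmOfDv
  /-- `BiCoricData.fxmDeltaHT`: `†ℋ𝒯 ↦ †𝔉^{⊢×μ}_△` (Frobenius-like) [IUTchII, Cor 4.10 (iv)] -/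
  fxmDeltaHT : HTRep FK ⥤ X.Fxm
  /-- `BiCoricData.kummer`: the Kummer isomorphisms `^{n,m}𝔉^{⊢×μ}_△ ⥲ F^{⊢×μ}_△(^{n,m}𝔇^⊢_△)` [Thm 1.5 (iii) p.50; IUTchII Cor 4.6 (i)],
  functorial in the Hodge theater (`†ℋ𝒯 ↦ †ℋ𝒯^𝒟` = `HTRep.toDFunctor`) -/
  kummer : fxmDeltaHT ≅ (HTRep.toDFunctor ⋙ dvDelta) ⋙ fxmOfDv
  /-- `BiCoricData.RFrob`: the data `(C^⊩, Prime(C^⊩) ⥲ 𝕍, {ρ_v}_v)` [Thm 1.5 (v) p.51] -/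
  RFrob : Type u
  [catRFrob : Category.{u} RFrob]
  /-- `BiCoricData.realified`: `†𝔇^⊢ ↦ (D^⊩(†𝔇^⊢), Prime ⥲ 𝕍, {ρ_{D^⊩,v}}_v)` [IUTchII, Cor 4.5 (ii)] -/
  realified : M.DMono ⥤ RFrob
  /-- `BiCoricData.realifiedHT`: `†ℋ𝒯 ↦ (^{n,m}C^⊩_△, Prime ⥲ 𝕍, {^{n,m}ρ_{△,v}}_v)` [IUTchII, Cor 4.10 (i)] -/
  realifiedHT : HTRep FK ⥤ RFrob
  /-- `BiCoricData.realifiedKummer`: "the `ℝ_{>0}`-orbits of the isomorphisms" of [IUTchII] Cor 4.6 (ii) [Thm 1.5 (v) p.51] -/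
  realifiedKummer : ∀ H : HTRep FK,
    PolyIso (realifiedHT.obj H) (realified.obj (dvDelta.obj (HTRep.toDFunctor.obj H)))
  /-- the `ℝ_{>0}`-orbit is nonempty -/
  realifiedKummer_nonempty : ∀ H : HTRep FK, (realifiedKummer H).Nonempty

attribute [instance] BiCoricKit.catSh BiCoricKit.catRFrob

/-! ### 3. The constructor -/

section OfKits

/-- **IUTchIII:Prop1.2(vi)** (kurims p.32) TRANSPORT LAW: the `Ism`-orbit (resp. `{±1}`-orbit) transported to the small models is again
stable under transport along isomorphisms of `F^{⊢×μ}`-prime-strips (kit-level `monoFxm_map`, re-wrapped).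
([IUTchIII] Prop 1.2 (vi) p.32) [claim: Mochizuki2012, status: disputed] -/
theorem BiCoricKit.liftPoly_monoFxm_map {X : TimesMuSide FK L} (Bk : BiCoricKit X)
    {A B : AsSmall.{max 1 u} X.Fxm} (f : A ≅ B)
    (e : (liftF.{max 1 u} Bk.monoShell).obj ((liftF.{max 1 u} X.FxmToDv).obj A) ≅ (liftF.{max 1 u} Bk.fxmShell).obj A)
    (he : e ∈ liftPoly.{max 1 u} (Bk.monoFxm (ULift.down A))) :
    ((liftF Bk.monoShell).mapIso ((liftF X.FxmToDv).mapIso f)).symm ≪≫ e ≪≫ (liftF Bk.fxmShell).mapIso f ∈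
      liftPoly.{max 1 u} (Bk.monoFxm (ULift.down B)) := by
  obtain ⟨e₀, he₀, rfl⟩ := he
  exact ⟨(Bk.monoShell.mapIso (X.FxmToDv.mapIso (AsSmall.down.mapIso f))).symm ≪≫ e₀ ≪≫
      Bk.fxmShell.mapIso (AsSmall.down.mapIso f),
    Bk.monoFxm_map (AsSmall.down.mapIso f) e₀ he₀, Iso.ext rfl⟩

variable (L) (hbij : FK.IsomFtoDBijective) (hsurj : FK.IsomFmtoDmSurjective) (hR : FK.RlfOfIsStrip)
  (X : TimesMuSide FK L) (Bk : BiCoricKit X)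

/-- **IUTchIII:Prop1.2(viii)** (kurims p.33) **`BiCoricData.ofKits`** — this seat's [IUTchIII] §1 interface `BiCoricData` (Def 1.1 (iv)–(vi),
Prop 1.2 (vi)–(ix), Thm 1.5 (iii)–(v)) INSTANTIATED over the real frame `StripFrame.ofKits L hbij hsurj hR X` from kit-level data
`Bk : BiCoricKit X`: categories := small models (`AsSmall`), functors := `liftF`, natural isomorphisms componentwise
(`liftUnit`, `liftSquare`, `liftIsoComp₃`), object-wise poly-isomorphisms := `liftPoly` (`PolyIso.map AsSmall.up`), the label
`≻ := PUnit.unit` (the frame's one label); the laws `monoFxm_map`, `monoFxmOfF_le` and the non-emptiness clauses PROVED from the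
kit-level ones. ([IUTchIII] Prop 1.2 (viii) p.33) [claim: Mochizuki2012, status: disputed] -/
noncomputable def BiCoricData.ofKits : BiCoricData (StripFrame.ofKits L hbij hsurj hR X) where
  Sh := AsSmall.{max 1 u} Bk.Sh
  holShell := liftF Bk.holShell
  fxmShell := liftF Bk.fxmShell
  monoShell := liftF Bk.monoShell
  monoFxm A := liftPoly (Bk.monoFxm (ULift.down A))
  monoFxm_nonempty A := liftPoly_nonempty (Bk.monoFxm_nonempty (ULift.down A))
  monoFxm_map f e he := Bk.liftPoly_monoFxm_map f e he
  monoFxmOfF F := liftPoly (Bk.monoFxmOfF (ULift.down F))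
  monoFxmOfF_nonempty F := liftPoly_nonempty (Bk.monoFxmOfF_nonempty (ULift.down F))
  monoFxmOfF_le F := liftPoly_mono (Bk.monoFxmOfF_le (ULift.down F))
  fxmHol F := liftPoly (Bk.fxmHol (ULift.down F))
  fxmHol_nonempty F := liftPoly_nonempty (Bk.fxmHol_nonempty (ULift.down F))
  FofD := liftF Bk.FofD
  FofD_D := liftUnit Bk.FofD_D
  fxmOfDv := liftF Bk.fxmOfDv
  fxmOfDv_dv := liftUnit Bk.fxmOfDv_dv
  dvDelta := liftF Bk.dvDelta
  succ := PUnit.unit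
  fxOfDsucc := liftF Bk.fxOfDsucc
  fxOfDsucc_delta := liftSquare Bk.fxOfDsucc_delta
  fxmDeltaHT := liftF Bk.fxmDeltaHT
  kummer := liftIsoComp₃ Bk.kummer
  RFrob := AsSmall.{max 1 u} Bk.RFrob
  realified := liftF Bk.realified
  realifiedHT := liftF Bk.realifiedHT
  realifiedKummer H := liftPoly (Bk.realifiedKummer (ULift.down H))
  realifiedKummer_nonempty H := liftPoly_nonempty (Bk.realifiedKummer_nonempty (ULift.down H))

/-- **IUTchII:Rmk4.5.1(i)** (kurims p.133) In the instance, `F(*𝔇)` of a `𝒟`-prime-strip of the frame IS (the small model of) the kit-level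
`F(*𝔇)` (SUBDAG-IUTchIII-Prop-12 row r16a: the `FofD` slot at the real frame). ([IUTchII] Rmk 4.5.1 (i) p.133)
[claim: Mochizuki2012, status: disputed] -/
theorem BiCoricData.ofKits_FofD_obj (D : (StripFrame.ofKits L hbij hsurj hR X).D) :
    (BiCoricData.ofKits L hbij hsurj hR X Bk).FofD.obj D = AsSmall.up.obj (Bk.FofD.obj (ULift.down D)) := rfl

/-- **IUTchIII:Thm1.5(iii)** (kurims p.49) In the instance, `F^{⊢×μ}_△(^{n,m}𝔇^⊢_△)` of a `𝒟^⊢`-prime-strip of the frame IS (the small model of)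
the kit-level one. ([IUTchIII] Thm 1.5 (iii) p.49) [claim: Mochizuki2012, status: disputed] -/
theorem BiCoricData.ofKits_fxmOfDv_obj (D : (StripFrame.ofKits L hbij hsurj hR X).Dv) :
    (BiCoricData.ofKits L hbij hsurj hR X Bk).fxmOfDv.obj D = AsSmall.up.obj (Bk.fxmOfDv.obj (ULift.down D)) := rfl

/-- **IUTchIII:Prop1.2(vi)** (kurims p.32) In the instance, an isomorphism belongs to the `Ism`-orbit (resp. `{±1}`-orbit) `log(†𝔇^⊢) ⥲ log(†𝔉^{⊢×μ})` iff
its underlying isomorphism belongs to the kit-level orbit. ([IUTchIII] Prop 1.2 (vi) p.32) [claim: Mochizuki2012, status: disputed] -/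
theorem BiCoricData.ofKits_mem_monoFxm_iff (A : (StripFrame.ofKits L hbij hsurj hR X).Fxm)
    (e : (BiCoricData.ofKits L hbij hsurj hR X Bk).monoShell.obj ((StripFrame.ofKits L hbij hsurj hR X).FxmToDv.obj A) ≅
      (BiCoricData.ofKits L hbij hsurj hR X Bk).fxmShell.obj A) :
    e ∈ (BiCoricData.ofKits L hbij hsurj hR X Bk).monoFxm A ↔ AsSmall.down.mapIso e ∈ Bk.monoFxm (ULift.down A) :=
  mem_liftPoly_iff _ e

/-- **IUTchIII:Thm1.5(v)** (kurims p.51) In the instance, an isomorphism belongs to the `ℝ_{>0}`-orbit of Kummer isomorphisms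
`(^{n,m}C^⊩_△, …) ⥲ (D^⊩(^{n,m}𝔇^⊢_△), …)` iff its underlying isomorphism belongs to the kit-level orbit.
([IUTchIII] Thm 1.5 (v) p.51) [claim: Mochizuki2012, status: disputed] -/
theorem BiCoricData.ofKits_mem_realifiedKummer_iff (H : (StripFrame.ofKits L hbij hsurj hR X).HT)
    (e : (BiCoricData.ofKits L hbij hsurj hR X Bk).realifiedHT.obj H ≅
      (BiCoricData.ofKits L hbij hsurj hR X Bk).realified.obj
        ((BiCoricData.ofKits L hbij hsurj hR X Bk).dvDelta.obj ((StripFrame.ofKits L hbij hsurj hR X).htToD.obj H))) :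
    e ∈ (BiCoricData.ofKits L hbij hsurj hR X Bk).realifiedKummer H ↔
      AsSmall.down.mapIso e ∈ Bk.realifiedKummer (ULift.down H) :=
  mem_liftPoly_iff _ e

/-- **IUTchIII:Prop1.2(viii)** (kurims p.33) Hence the interface `BiCoricData` over the real frame is INHABITED as soon as kit-level
bi-coric data are given (the input of `LatticeGlue.ofKits`). ([IUTchIII] Prop 1.2 (viii) p.33) [claim: Mochizuki2012, status: disputed] -/
theorem nonempty_biCoricData_ofKits (h : Nonempty (BiCoricKit X)) :
    Nonempty (BiCoricData (StripFrame.ofKits L hbij hsurj hR X)) :=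
  ⟨BiCoricData.ofKits L hbij hsurj hR X h.some⟩

end OfKits

end Literature.IUT.LogThetaLattice
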